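import Literature.NumberTheory.LFunctions.ConreyIwaniec2002MeanValueDefs
import HarnessLib

/-!
# Conrey–Iwaniec (2002), Corollary 6.2: the scaling `a(y) ↦ a(y)(T/y)^{1/2}` (6.38) → (6.14)

B. Conrey, H. Iwaniec, Acta Arith. 103 (2002), §6, proof of Corollary 6.2 (6.37)–(6.39) [held text
`paper:arxiv-math_0111012`, p0016]: "we change `a(y)` into `a(y)(T/y)^{1/2}`; the new function
satisfies (6.14), so the result follows by dividing (6.36) by `T`". Here: for `a` in the class
(6.38) (`IsCutoff a T Y`, `T ≤ Y`) the function `a♯(y) = a(y)(T/y)^{1/2}/64` is in the class (6.14)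
(`IsCutoff14 a♯ Y`) — the absolute factor `64` absorbs the Leibniz constants; `a♯(0) = 0`;
`|a♯(y)|² = |a(y)|²(T/y)/64²`; the sequence `b_n = λ(n)a♯(n)` has `|b_n| ≤ τ(n)(1+n/Y)⁻⁴` (6.16);
`Σ b_n n^{-it} = (T^{1/2}/64)·Σ a(n)λ(n)n^{-1/2-it}`; and `K ≥ c₀𝟙_{[1,2]}`, `K ≥ 0` give
`c₀∫_T^{2T}F ≤ ∫K(t/T)F(t)dt` for `F ≥ 0`.

PROVED HERE (namespace `ConreyIwaniec2002.Thm61Scaling`, one def `sharp`): helpers for stub S2c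
`stub_thm61_assembly` of SKELETON P64 (line `thm61-cm-convolution`).

## References
* [ConreyIwaniec2002] B. Conrey, H. Iwaniec, Acta Arith. 103 (2002) 259–312: §6 (6.14), (6.16),
  (6.37)–(6.39).
-/

noncomputable section

open Complex MeasureTheory Set Filter Real
open scoped Topology

namespace Literature.NumberTheory.LFunctions

namespace ConreyIwaniec2002

namespace Thm61Scaling

/-! ### The weight `W(y) = (T^{1/2}/64)·y^{-1/2}` and its first two derivatives -/

/-- The scaling weight `W_T(y) = (T^{1/2}/64)·y^{-1/2}` (complex-valued).
[cite: ConreyIwaniec2002, §6 (6.37)–(6.39)] -/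
def sharpW (T : ℝ) (y : ℝ) : ℂ := (((T ^ (1 / 2 : ℝ) / 64 * y ^ (-(1 / 2 : ℝ))) : ℝ) : ℂ)

/-- **`a♯(y) = a(y)·(T/y)^{1/2}/64`** (Corollary 6.2's substitution, normalised).
[cite: ConreyIwaniec2002, §6 (6.37)–(6.39)] -/
def sharp (a : ℝ → ℂ) (T : ℝ) (y : ℝ) : ℂ := a y * sharpW T y

/-- `a♯(0) = 0`. [cite: ConreyIwaniec2002, §6 (6.39)] -/
theorem sharp_zero (a : ℝ → ℂ) (T : ℝ) : sharp a T 0 = 0 := by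
  simp [sharp, sharpW]

/-- `|a♯(y)|² = |a(y)|²·(T/y)/64²` for `y > 0`, `T ≥ 0`. [cite: ConreyIwaniec2002, §6 (6.39)] -/
theorem norm_sq_sharp {a : ℝ → ℂ} {T y : ℝ} (hT : 0 ≤ T) (hy : 0 < y) :
    ‖sharp a T y‖ ^ 2 = ‖a y‖ ^ 2 * (T / y) / 64 ^ 2 := by
  rw [sharp, norm_mul, mul_pow, sharpW, Complex.norm_real, Real.norm_eq_abs, sq_abs, mul_pow,
    div_pow, ← Real.rpow_natCast (T ^ (1 / 2 : ℝ)) 2, ← Real.rpow_mul hT,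
    ← Real.rpow_natCast (y ^ (-(1 / 2 : ℝ))) 2, ← Real.rpow_mul hy.le]
  norm_num
  rw [Real.rpow_neg_one]
  ring

/-- The derivatives of `W`: on `y > 0`, `W`, `W'`, `W''` are `c y^{-1/2}`, `-(c/2) y^{-3/2}`,
`(3c/4) y^{-5/2}` with `c = T^{1/2}/64`. [cite: ConreyIwaniec2002, §6 (6.39)] -/
theorem hasDerivAt_sharpW {T y : ℝ} (hy : 0 < y) :
    HasDerivAt (sharpW T) ((((T ^ (1 / 2 : ℝ) / 64 * (-(1 / 2 : ℝ) * y ^ (-(1 / 2 : ℝ) - 1))) : ℝ) : ℂ)) y := by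
  unfold sharpW
  exact ((Real.hasDerivAt_rpow_const (Or.inl hy.ne')).const_mul _).ofReal_comp

/-- `W'` near `y > 0`. [cite: ConreyIwaniec2002, §6 (6.39)] -/
theorem deriv_sharpW_eventually {T y : ℝ} (hy : 0 < y) :
    deriv (sharpW T) =ᶠ[𝓝 y]
      fun z => (((T ^ (1 / 2 : ℝ) / 64 * (-(1 / 2 : ℝ) * z ^ (-(1 / 2 : ℝ) - 1))) : ℝ) : ℂ) := by
  filter_upwards [Ioi_mem_nhds hy] with z hz
  exact (hasDerivAt_sharpW hz).deriv

/-- `W''(y)` for `y > 0`. [cite: ConreyIwaniec2002, §6 (6.39)] -/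
theorem hasDerivAt_deriv_sharpW {T y : ℝ} (hy : 0 < y) :
    HasDerivAt (deriv (sharpW T))
      ((((T ^ (1 / 2 : ℝ) / 64 * (-(1 / 2 : ℝ) * ((-(1 / 2 : ℝ) - 1) * y ^ (-(1 / 2 : ℝ) - 1 - 1)))) : ℝ) : ℂ)) y := by
  have h : HasDerivAt (fun z : ℝ => (((T ^ (1 / 2 : ℝ) / 64 * (-(1 / 2 : ℝ) * z ^ (-(1 / 2 : ℝ) - 1))) : ℝ) : ℂ))
      ((((T ^ (1 / 2 : ℝ) / 64 * (-(1 / 2 : ℝ) * ((-(1 / 2 : ℝ) - 1) * y ^ (-(1 / 2 : ℝ) - 1 - 1)))) : ℝ) : ℂ)) y :=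
    (((Real.hasDerivAt_rpow_const (Or.inl hy.ne')).const_mul _).const_mul _).ofReal_comp
  exact h.congr_of_eventuallyEq (deriv_sharpW_eventually hy)

/-- Norms of `W, W', W''` with the weights `1, y, y²`: all `≤ (T^{1/2}/64)·y^{-1/2}` times
`1, 1/2, 3/4`. [cite: ConreyIwaniec2002, §6 (6.39)] -/
theorem norm_iteratedDeriv_sharpW_le {T y : ℝ} (hT : 0 ≤ T) (hy : 0 < y) :
    ‖iteratedDeriv 0 (sharpW T) y‖ = T ^ (1 / 2 : ℝ) / 64 * y ^ (-(1 / 2 : ℝ)) ∧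
    y * ‖iteratedDeriv 1 (sharpW T) y‖ = 1 / 2 * (T ^ (1 / 2 : ℝ) / 64 * y ^ (-(1 / 2 : ℝ))) ∧
    y ^ 2 * ‖iteratedDeriv 2 (sharpW T) y‖ = 3 / 4 * (T ^ (1 / 2 : ℝ) / 64 * y ^ (-(1 / 2 : ℝ))) := by
  have hc : 0 ≤ T ^ (1 / 2 : ℝ) / 64 := by positivity
  have hp : ∀ r : ℝ, 0 < y ^ r := fun r => Real.rpow_pos_of_pos hy r
  refine ⟨?_, ?_, ?_⟩
  · rw [iteratedDeriv_zero, sharpW, Complex.norm_real, Real.norm_eq_abs,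
      abs_of_nonneg (mul_nonneg hc (hp _).le)]
  · rw [iteratedDeriv_one, (hasDerivAt_sharpW hy).deriv, Complex.norm_real, Real.norm_eq_abs]
    rw [show T ^ (1 / 2 : ℝ) / 64 * (-(1 / 2 : ℝ) * y ^ (-(1 / 2 : ℝ) - 1)) =
      -(1 / 2 * (T ^ (1 / 2 : ℝ) / 64) * y ^ (-(1 / 2 : ℝ) - 1)) by ring, abs_neg,
      abs_of_nonneg (by positivity), Real.rpow_sub hy, Real.rpow_one]
    field_simp
  · rw [iteratedDeriv_succ, iteratedDeriv_one, (hasDerivAt_deriv_sharpW hy).deriv, Complex.norm_real,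
      Real.norm_eq_abs]
    rw [show T ^ (1 / 2 : ℝ) / 64 * (-(1 / 2 : ℝ) * ((-(1 / 2 : ℝ) - 1) * y ^ (-(1 / 2 : ℝ) - 1 - 1))) =
      3 / 4 * (T ^ (1 / 2 : ℝ) / 64) * y ^ (-(1 / 2 : ℝ) - 1 - 1) by ring,
      abs_of_nonneg (by positivity), Real.rpow_sub hy, Real.rpow_sub hy, Real.rpow_one]
    field_simp

/-- `W` is smooth on `(0,∞)`. [cite: ConreyIwaniec2002, §6 (6.39)] -/
theorem contDiffOn_sharpW (T : ℝ) {n : ℕ∞} : ContDiffOn ℝ n (sharpW T) (Ioi 0) := by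
  have h1 : ContDiffOn ℝ n (fun z : ℝ => z ^ (-(1 / 2 : ℝ))) (Ioi 0) := fun y hy =>
    (Real.contDiffAt_rpow_const_of_ne (ne_of_gt hy)).contDiffWithinAt
  have h2 : ContDiffOn ℝ n (fun z : ℝ => T ^ (1 / 2 : ℝ) / 64 * z ^ (-(1 / 2 : ℝ))) (Ioi 0) :=
    contDiffOn_const.mul h1
  refine (Complex.ofRealCLM.contDiff.comp_contDiffOn h2).congr fun y _ => ?_
  simp [sharpW]

/-! ### `a♯` is in the class (6.14) -/

/-- The key weight comparison: `(1+y/Y+T/y)^{-4}·(T/y)^{1/2} ≤ 16(1+y/Y)^{-4}` for `0 < T ≤ Y`,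
`y > 0`. [cite: ConreyIwaniec2002, §6 (6.37)–(6.39)] -/
theorem weight_sqrt_le {T Y y : ℝ} (hT : 0 < T) (hTY : T ≤ Y) (hy : 0 < y) :
    ((1 + y / Y + T / y) ^ 4)⁻¹ * (T ^ (1 / 2 : ℝ) * y ^ (-(1 / 2 : ℝ))) ≤ 16 * ((1 + y / Y) ^ 4)⁻¹ := by
  have hY : 0 < Y := lt_of_lt_of_le hT hTY
  have hs : T ^ (1 / 2 : ℝ) * y ^ (-(1 / 2 : ℝ)) = (T / y) ^ (1 / 2 : ℝ) := by
    rw [Real.div_rpow hT.le hy.le, Real.rpow_neg hy.le]; ring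
  rw [hs]
  have hu : 0 ≤ y / Y := by positivity
  have hv : 0 < T / y := by positivity
  have hB1 : 1 ≤ 1 + y / Y := by linarith
  have hbase : 1 + y / Y ≤ 1 + y / Y + T / y := by linarith
  rcases le_or_gt T y with hTy | hyT
  · -- `T ≤ y`: `(T/y)^{1/2} ≤ 1` and `B ≤ (1+y/Y)^{-4}`
    have h1 : (T / y) ^ (1 / 2 : ℝ) ≤ 1 :=
      Real.rpow_le_one hv.le ((div_le_one hy).mpr hTy) (by norm_num)
    have h2 : ((1 + y / Y + T / y) ^ 4)⁻¹ ≤ ((1 + y / Y) ^ 4)⁻¹ :=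
      inv_anti₀ (by positivity) (pow_le_pow_left₀ (by positivity) hbase 4)
    have h3 : 0 ≤ ((1 + y / Y) ^ 4)⁻¹ := by positivity
    calc ((1 + y / Y + T / y) ^ 4)⁻¹ * (T / y) ^ (1 / 2 : ℝ) ≤ ((1 + y / Y) ^ 4)⁻¹ * 1 :=
          mul_le_mul h2 h1 (by positivity) h3
      _ ≤ 16 * ((1 + y / Y) ^ 4)⁻¹ := by linarith
  · -- `y < T`: `y/Y < 1` so `16(1+y/Y)^{-4} > 1`, while `B (T/y)^{1/2} ≤ 1`
    have hv1 : 1 ≤ T / y := (one_le_div hy).mpr hyT.le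
    have h1 : (T / y) ^ (1 / 2 : ℝ) ≤ (1 + y / Y + T / y) ^ 4 := by
      calc (T / y) ^ (1 / 2 : ℝ) ≤ (T / y) ^ (1 : ℝ) :=
            Real.rpow_le_rpow_of_exponent_le hv1 (by norm_num)
        _ = T / y := Real.rpow_one _
        _ ≤ (1 + y / Y + T / y) ^ 1 := by rw [pow_one]; linarith
        _ ≤ (1 + y / Y + T / y) ^ 4 := pow_le_pow_right₀ (by linarith) (by norm_num)
    have h2 : ((1 + y / Y + T / y) ^ 4)⁻¹ * (T / y) ^ (1 / 2 : ℝ) ≤ 1 := by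
      rw [inv_mul_le_iff₀ (by positivity), mul_one]; exact h1
    have huY : y / Y < 1 := (div_lt_one hY).mpr (lt_of_lt_of_le hyT hTY)
    have h3 : (1 + y / Y) ^ 4 < 16 := by
      calc (1 + y / Y) ^ 4 < 2 ^ 4 := pow_lt_pow_left₀ (by linarith) (by linarith) (by norm_num)
        _ = 16 := by norm_num
    have h4 : 1 ≤ 16 * ((1 + y / Y) ^ 4)⁻¹ := by
      rw [← div_eq_mul_inv, le_div_iff₀ (by positivity)]; linarith
    linarith

/-- **`a♯ ∈` the class (6.14):** `IsCutoff a T Y`, `2 ≤ T ≤ Y` ⟹ `IsCutoff14 (sharp a T) Y`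
(Leibniz: `y^ν|∂^ν(aW)| ≤ Σ C(ν,i)(y^i|a^{(i)}|)(y^{ν-i}|W^{(ν-i)}|) ≤ (11/4)(1+y/Y+T/y)^{-4}(T/y)^{1/2}/64
≤ (11/16)(1+y/Y)^{-4}`). [cite: ConreyIwaniec2002, §6 (6.14), (6.37)–(6.39)] -/
theorem isCutoff14_sharp {a : ℝ → ℂ} {T Y : ℝ} (hT : 2 ≤ T) (hTY : T ≤ Y) (ha : IsCutoff a T Y) :
    IsCutoff14 (sharp a T) Y := by
  have hT0 : 0 < T := by linarith
  refine ⟨ha.1.mul (contDiffOn_sharpW T), ?_⟩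
  intro ν hν y hy
  have hopen : IsOpen (Ioi (0:ℝ)) := isOpen_Ioi
  have hL := norm_iteratedFDerivWithin_mul_le (𝕜 := ℝ) (A := ℂ) (n := ν) (N := 2) ha.1
    (contDiffOn_sharpW T) (uniqueDiffOn_Ioi 0) hy (by exact_mod_cast hν)
  have hconv : ∀ (g : ℝ → ℂ) (i : ℕ), ‖iteratedFDerivWithin ℝ i g (Ioi 0) y‖ = ‖iteratedDeriv i g y‖ := by
    intro g i
    rw [norm_iteratedFDerivWithin_eq_norm_iteratedDerivWithin, iteratedDerivWithin_of_isOpen hopen hy]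
  have hfold : (fun z => a z * sharpW T z) = sharp a T := rfl
  rw [hfold, hconv] at hL
  -- the available bounds
  set B : ℝ := ((1 + y / Y + T / y) ^ 4)⁻¹ with hB
  set cs : ℝ := T ^ (1 / 2 : ℝ) / 64 * y ^ (-(1 / 2 : ℝ)) with hcs
  have hB0 : 0 ≤ B := by positivity
  have hcs0 : 0 ≤ cs := by positivity
  have ha0 : ‖iteratedDeriv 0 a y‖ ≤ B := by simpa using ha.2 0 (by norm_num) y hy
  have ha1 : y * ‖iteratedDeriv 1 a y‖ ≤ B := by simpa using ha.2 1 (by norm_num) y hy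
  have ha2 : y ^ 2 * ‖iteratedDeriv 2 a y‖ ≤ B := ha.2 2 le_rfl y hy
  obtain ⟨hW0, hW1, hW2⟩ := norm_iteratedDeriv_sharpW_le (T := T) hT0.le hy
  have hkey : B * cs ≤ (1 / 4) * ((1 + y / Y) ^ 4)⁻¹ := by
    have h := weight_sqrt_le hT0 hTY hy
    rw [hcs, show B * (T ^ (1 / 2 : ℝ) / 64 * y ^ (-(1 / 2 : ℝ))) =
      (B * (T ^ (1 / 2 : ℝ) * y ^ (-(1 / 2 : ℝ)))) / 64 by ring]
    linarith
  have hn0 : 0 ≤ ‖iteratedDeriv 0 a y‖ := norm_nonneg _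
  have hn1 : 0 ≤ ‖iteratedDeriv 1 a y‖ := norm_nonneg _
  have hn2 : 0 ≤ ‖iteratedDeriv 2 a y‖ := norm_nonneg _
  interval_cases ν
  · -- ν = 0
    simp only [Finset.sum_range_succ, Finset.sum_range_zero, Nat.choose_self, Nat.cast_one, one_mul,
      zero_add, Nat.sub_zero, hconv] at hL
    rw [pow_zero, one_mul]
    calc ‖iteratedDeriv 0 (sharp a T) y‖ ≤ ‖iteratedDeriv 0 a y‖ * ‖iteratedDeriv 0 (sharpW T) y‖ := hL
      _ ≤ B * cs := by rw [hW0]; exact mul_le_mul_of_nonneg_right ha0 hcs0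
      _ ≤ ((1 + y / Y) ^ 4)⁻¹ := by linarith [show 0 ≤ ((1 + y / Y) ^ 4)⁻¹ by positivity]
  · -- ν = 1
    simp only [Finset.sum_range_succ, Finset.sum_range_zero, zero_add, Nat.choose_zero_right,
      Nat.choose_self, Nat.cast_one, one_mul, Nat.sub_zero, Nat.sub_self, hconv] at hL
    rw [pow_one]
    calc y * ‖iteratedDeriv 1 (sharp a T) y‖
        ≤ y * (‖iteratedDeriv 0 a y‖ * ‖iteratedDeriv 1 (sharpW T) y‖ +
            ‖iteratedDeriv 1 a y‖ * ‖iteratedDeriv 0 (sharpW T) y‖) :=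
          mul_le_mul_of_nonneg_left hL hy.le
      _ = ‖iteratedDeriv 0 a y‖ * (y * ‖iteratedDeriv 1 (sharpW T) y‖) +
            (y * ‖iteratedDeriv 1 a y‖) * ‖iteratedDeriv 0 (sharpW T) y‖ := by ring
      _ ≤ B * (1 / 2 * cs) + B * cs := by
          rw [hW1, hW0]
          exact add_le_add (mul_le_mul_of_nonneg_right ha0 (by positivity))
            (mul_le_mul_of_nonneg_right ha1 hcs0)
      _ ≤ ((1 + y / Y) ^ 4)⁻¹ := by nlinarith [show 0 ≤ ((1 + y / Y) ^ 4)⁻¹ by positivity]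
  · -- ν = 2
    simp only [Finset.sum_range_succ, Finset.sum_range_zero, zero_add, Nat.choose_zero_right,
      Nat.choose_self, Nat.cast_one, one_mul, Nat.sub_zero, Nat.sub_self,
      show Nat.choose 2 1 = 2 by rfl, Nat.cast_ofNat, hconv] at hL
    calc y ^ 2 * ‖iteratedDeriv 2 (sharp a T) y‖
        ≤ y ^ 2 * (‖iteratedDeriv 0 a y‖ * ‖iteratedDeriv 2 (sharpW T) y‖ +
            2 * ‖iteratedDeriv 1 a y‖ * ‖iteratedDeriv 1 (sharpW T) y‖ +
            ‖iteratedDeriv 2 a y‖ * ‖iteratedDeriv 0 (sharpW T) y‖) :=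
          mul_le_mul_of_nonneg_left hL (by positivity)
      _ = ‖iteratedDeriv 0 a y‖ * (y ^ 2 * ‖iteratedDeriv 2 (sharpW T) y‖) +
            2 * ((y * ‖iteratedDeriv 1 a y‖) * (y * ‖iteratedDeriv 1 (sharpW T) y‖)) +
            (y ^ 2 * ‖iteratedDeriv 2 a y‖) * ‖iteratedDeriv 0 (sharpW T) y‖ := by ring
      _ ≤ B * (3 / 4 * cs) + 2 * (B * (1 / 2 * cs)) + B * cs := by
          rw [hW2, hW1, hW0]
          refine add_le_add (add_le_add (mul_le_mul_of_nonneg_right ha0 (by positivity)) ?_)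
            (mul_le_mul_of_nonneg_right ha2 hcs0)
          exact mul_le_mul_of_nonneg_left (mul_le_mul_of_nonneg_right ha1 (by positivity)) (by norm_num)
      _ ≤ ((1 + y / Y) ^ 4)⁻¹ := by nlinarith [show 0 ≤ ((1 + y / Y) ^ 4)⁻¹ by positivity]

/-- The `ν = 0` case of (6.14): `|g(y)| ≤ (1+y/Y)⁻⁴` for `y > 0`. [cite: ConreyIwaniec2002, §6 (6.14)] -/
theorem norm_le_of_isCutoff14 {g : ℝ → ℂ} {Y y : ℝ} (hg : IsCutoff14 g Y) (hy : 0 < y) :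
    ‖g y‖ ≤ ((1 + y / Y) ^ 4)⁻¹ := by
  simpa using hg.2 0 (by norm_num) y hy

/-- The `ν = 0` case of (6.38): `|a(y)| ≤ (1+y/Y+T/y)⁻⁴ ≤ (1+y/Y)⁻⁴` for `y > 0` (`T ≥ 0`).
[cite: ConreyIwaniec2002, §6 (6.38)] -/
theorem norm_le_of_isCutoff {a : ℝ → ℂ} {T Y y : ℝ} (ha : IsCutoff a T Y) (hT : 0 ≤ T) (hY : 0 < Y)
    (hy : 0 < y) :
    ‖a y‖ ≤ ((1 + y / Y + T / y) ^ 4)⁻¹ ∧ ‖a y‖ ≤ ((1 + y / Y) ^ 4)⁻¹ := by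
  have h0 : ‖a y‖ ≤ ((1 + y / Y + T / y) ^ 4)⁻¹ := by simpa using ha.2 0 (by norm_num) y hy
  refine ⟨h0, h0.trans (inv_anti₀ (by positivity) (pow_le_pow_left₀ (by positivity) ?_ 4))⟩
  have : 0 ≤ T / y := by positivity
  linarith

/-! ### The sequence `b_n = λ(n)a♯(n)` and the scaling of the L-series -/

/-- `W_T(n) = (T^{1/2}/64)·n^{-1/2}` as a complex power (`n ∈ ℕ`). [cite: ConreyIwaniec2002, §6 (6.39)] -/
theorem sharpW_natCast (T : ℝ) (n : ℕ) :
    sharpW T n = (((T ^ (1 / 2 : ℝ) / 64 : ℝ)) : ℂ) * ((n : ℂ) ^ (1 / 2 : ℂ))⁻¹ := by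
  have hn0 : (0 : ℝ) ≤ n := Nat.cast_nonneg n
  rw [sharpW, Complex.ofReal_mul, Complex.ofReal_cpow hn0, Complex.ofReal_natCast, ← Complex.cpow_neg]
  congr 1
  push_cast
  ring_nf

/-- **(6.16): `|b_n| ≤ τ(n)(1+n/Y)⁻⁴`** for `b_n = λ(n)a♯(n)`, `|λ(n)| ≤ τ(n)`, `n ≥ 1`.
[cite: ConreyIwaniec2002, §6 (6.16)] -/
theorem norm_b_le {a : ℝ → ℂ} {T Y : ℝ} (hT : 2 ≤ T) (hTY : T ≤ Y) (ha : IsCutoff a T Y)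
    {lam : ℕ → ℂ} (hlam : ∀ n : ℕ, 1 ≤ n → ‖lam n‖ ≤ (Nat.divisors n).card) {n : ℕ} (hn : 1 ≤ n) :
    ‖lam n * sharp a T n‖ ≤ (Nat.divisors n).card * ((1 + (n : ℝ) / Y) ^ 4)⁻¹ := by
  rw [norm_mul]
  have hn0 : (0 : ℝ) < n := by exact_mod_cast hn
  exact mul_le_mul (hlam n hn) (norm_le_of_isCutoff14 (isCutoff14_sharp hT hTY ha) hn0)
    (norm_nonneg _) (Nat.cast_nonneg _)

/-- `|b_n|² = (T/64²)·|a(n)λ(n)|²/n` (all `n`, with `0/0 = 0`). [cite: ConreyIwaniec2002, §6 (6.39)–(6.40)] -/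
theorem norm_sq_b_eq {a : ℝ → ℂ} {T : ℝ} (hT : 0 ≤ T) (lam : ℕ → ℂ) (n : ℕ) :
    ‖lam n * sharp a T n‖ ^ 2 = T / 64 ^ 2 * (‖a n * lam n‖ ^ 2 / n) := by
  rcases Nat.eq_zero_or_pos n with rfl | hn
  · simp [sharp_zero]
  · have hn0 : (0 : ℝ) < n := by exact_mod_cast hn
    rw [norm_mul, mul_pow, norm_sq_sharp hT hn0, norm_mul, mul_pow]
    field_simp

/-- **`G_b = (T/64²)·G`**: `Σ|b_n|² = (T/64²)Σ|a(n)λ(n)|²/n`. [cite: ConreyIwaniec2002, §6 (6.40)] -/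
theorem tsum_norm_sq_b_eq {a : ℝ → ℂ} {T : ℝ} (hT : 0 ≤ T) (lam : ℕ → ℂ) :
    ∑' n : ℕ, ‖lam n * sharp a T n‖ ^ 2 = T / 64 ^ 2 * ∑' n : ℕ, ‖a n * lam n‖ ^ 2 / (n : ℝ) := by
  rw [← tsum_mul_left]
  exact tsum_congr fun n => norm_sq_b_eq hT lam n

/-- **`Σ b_n n^{-it} = (T^{1/2}/64)·Σ a(n)λ(n)n^{-1/2-it}`**. [cite: ConreyIwaniec2002, §6 (6.39)] -/
theorem LSeries_b_eq {a : ℝ → ℂ} {T : ℝ} (lam : ℕ → ℂ) (t : ℝ) :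
    LSeries (fun n => lam n * sharp a T n) (t * I) =
      (((T ^ (1 / 2 : ℝ) / 64 : ℝ)) : ℂ) * LSeries (fun n => a n * lam n) (1 / 2 + t * I) := by
  rw [LSeries, LSeries, ← tsum_mul_left]
  refine tsum_congr fun n => ?_
  rcases Nat.eq_zero_or_pos n with rfl | hn
  · simp
  have hn' : n ≠ 0 := by omega
  have hnC : (n : ℂ) ≠ 0 := Nat.cast_ne_zero.mpr hn'
  have hc1 : (n : ℂ) ^ (1 / 2 : ℂ) ≠ 0 := by
    rw [Complex.cpow_def_of_ne_zero hnC]; exact Complex.exp_ne_zero _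
  have hc2 : (n : ℂ) ^ ((t : ℂ) * I) ≠ 0 := by
    rw [Complex.cpow_def_of_ne_zero hnC]; exact Complex.exp_ne_zero _
  rw [LSeries.term_of_ne_zero hn', LSeries.term_of_ne_zero hn', sharp, sharpW_natCast,
    Complex.cpow_add _ _ hnC]
  field_simp

/-- `|Σ b_n n^{-it}|² = (T/64²)|Σ a(n)λ(n)n^{-1/2-it}|²`. [cite: ConreyIwaniec2002, §6 (6.39)] -/
theorem norm_sq_LSeries_b_eq {a : ℝ → ℂ} {T : ℝ} (hT : 0 ≤ T) (lam : ℕ → ℂ) (t : ℝ) :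
    ‖LSeries (fun n => lam n * sharp a T n) (t * I)‖ ^ 2 =
      T / 64 ^ 2 * ‖LSeries (fun n => a n * lam n) (1 / 2 + t * I)‖ ^ 2 := by
  rw [LSeries_b_eq, norm_mul, mul_pow, Complex.norm_real, Real.norm_eq_abs, sq_abs, div_pow,
    ← Real.rpow_natCast (T ^ (1 / 2 : ℝ)) 2, ← Real.rpow_mul hT]
  norm_num

/-! ### Continuity of the L-series on `Re s = 1/2` and the kernel lower bound -/

/-- If `Σ‖f(n)‖n^{-1/2} < ∞` then `t ↦ Σ f(n)n^{-1/2-it}` is continuous (the integrand of (6.39)).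
[cite: ConreyIwaniec2002, §6 (6.39)] -/
theorem continuous_LSeries_half_line {f : ℕ → ℂ}
    (hf : Summable fun n : ℕ => ‖f n‖ * (n : ℝ) ^ (-(1 / 2 : ℝ))) :
    Continuous fun t : ℝ => LSeries f (1 / 2 + t * I) := by
  unfold LSeries
  refine continuous_tsum (fun n => ?_) hf (fun n t => ?_)
  · rcases Nat.eq_zero_or_pos n with rfl | hn
    · simp only [LSeries.term_zero]; exact continuous_const
    · have hn' : n ≠ 0 := by omega
      have hnC : (n : ℂ) ≠ 0 := Nat.cast_ne_zero.mpr hn'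
      simp only [LSeries.term_of_ne_zero hn']
      refine Continuous.div continuous_const ?_ fun t => ?_
      · exact continuous_iff_continuousAt.mpr fun t =>
          (continuousAt_const_cpow hnC).comp (by fun_prop : Continuous fun t : ℝ => (1 / 2 : ℂ) + t * I).continuousAt
      · rw [Complex.cpow_def_of_ne_zero hnC]; exact Complex.exp_ne_zero _
  · rw [LSeries.norm_term_eq]
    rcases Nat.eq_zero_or_pos n with rfl | hn
    · simp
    · have hn0 : (0:ℝ) < n := by exact_mod_cast hn
      simp only [show n ≠ 0 by omega, if_false, Complex.add_re, Complex.mul_re, Complex.ofReal_re,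
        Complex.I_re, Complex.ofReal_im, Complex.I_im, mul_zero, mul_one, sub_self, add_zero]
      rw [show ((1 / 2 : ℂ)).re = 1 / 2 by norm_num, div_eq_mul_inv, ← Real.rpow_neg hn0.le]

/-- **`K ≥ c₀𝟙_{[1,2]}`, `K ≥ 0` ⟹ `c₀∫_T^{2T}F ≤ ∫K(t/T)F(t)dt`** for `F ≥ 0`.
[cite: ConreyIwaniec2002, §6 (6.36), (6.39)] -/
theorem kernel_lower_bound {K : ℝ → ℝ} {c₀ T : ℝ} (hK0 : ∀ u, 0 ≤ K u)
    (hKc : ∀ u ∈ Icc (1 : ℝ) 2, c₀ ≤ K u) (hT : 0 < T) {F : ℝ → ℝ} (hF0 : ∀ t, 0 ≤ F t)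
    (hFi : Integrable fun t : ℝ => K (t / T) * F t) (hFint : IntervalIntegrable F volume T (2 * T)) :
    c₀ * ∫ t in T..2 * T, F t ≤ ∫ t : ℝ, K (t / T) * F t := by
  have hT2 : T ≤ 2 * T := by linarith
  calc c₀ * ∫ t in T..2 * T, F t = ∫ t in T..2 * T, c₀ * F t := by
        rw [intervalIntegral.integral_const_mul]
    _ ≤ ∫ t in T..2 * T, K (t / T) * F t := by
        refine intervalIntegral.integral_mono_on hT2 (hFint.const_mul c₀) hFi.intervalIntegrable
          fun t ht => ?_
        refine mul_le_mul_of_nonneg_right (hKc _ ⟨?_, ?_⟩) (hF0 t)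
        · rw [le_div_iff₀ hT]; linarith [ht.1]
        · rw [div_le_iff₀ hT]; linarith [ht.2]
    _ = ∫ t in Ioc T (2 * T), K (t / T) * F t := intervalIntegral.integral_of_le hT2
    _ ≤ ∫ t : ℝ, K (t / T) * F t :=
        setIntegral_le_integral hFi (Eventually.of_forall fun t => mul_nonneg (hK0 _) (hF0 t))

end Thm61Scaling

end ConreyIwaniec2002

end Literature.NumberTheory.LFunctions

end
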